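import Summits.ValiantsHypothesis.ValiantsHypothesis.Theorems.LacunarySymmetroidMatrixDescartesDoorA26WallBubblingConfluentTower
import Summits.ValiantsHypothesis.ValiantsHypothesis.Theorems.LacunarySymmetroidMatrixDescartesDoorA26WallBubblingConfluentCount

/-!
# Wall bubbling for `DoorA26` — the WALL DOOR STEP: no twenty in the limit window when the limit is the confluent determinant ON the wall (door-free)

LINE / STUBS.  Crux `Theses.LacunarySymmetroid.DoorA26` (stmt-ValiantsHypothesis-19979; OPEN, typed, never asserted), line
`Cruxes/DoorA26/Lines/wall_bubbling.lean` (val-idea-15); serves `Stmt.weylFaces_wall` (rev-3 statement file), EXIT side.  W2's door step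
`…WallBubblingConfluentTower.no_twenty_window_of_confluentDoor` (p653192) is the last step of «ConfluentDoor26 ⇒ Stmt.weylFaces_generic»: smooth window
functions converging with all derivatives up to order `19` to a non-identically-zero confluent `(2,6)` determinant cannot each carry `20` zeros — GIVEN
the door as a hypothesis.  On the WALL stratum the limit exponents `e` carry a pair-sum coincidence (one Weyl pair: case (a) `e_k + e_l = e_m + e_n`,
case (b) `e₀ + e_k = e_l + e_m`; line lead 2026-08-28T18:39Z/18:40Z), the extra confluent slots die (`…WallBubblingRelativeDSieve`,
`…WallBubblingWallExitMoments`), so the limit object IS the confluent determinant with `e` on the wall, and there `…WallBubblingConfluentCount`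
proves the door's conclusion outright.  This file is the door step WITH THE DOOR DISCHARGED (def-free, determinant inlined as in `ConfluentDoor26`):

* `no_twenty_window_of_coincidence` — smooth `f ν` converging continuously with all derivatives `< 20` on `[A,B]` to the confluent determinant with
  exponents carrying a coincidence of two distinct canonical pair sums, `F ≢ 0`, each `f ν` with `20` distinct zeros in `[A,B]` ⇒ `False`.
  (`multiplicity_transfer_iteratedDeriv` + `confluentDoor_conclusion_of_coincidence`; no door, no symmetry, no injectivity — `hcoin` also admits
  `a = b`, `c = d`, `a ≠ c`, i.e. REPEATED exponents `e a = e c`, which merge even more classes and give even fewer slots; same binder shape as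
  #12's lemma.)

HONEST LIMITS.  The exit of `Stmt.weylFaces_wall` (one Weyl pair) is this step fed by the shared middle (W2's level selection / class towers / multi-
class assembly) and by the slot vanishing of `…RelativeDSieve` + `…WallExitMoments`; that WIRING is not in this file; TWO Weyl pairs = NAMED OPEN
(`…WallExitMoments` header).  Nothing here bears on (W)/(M)/(R) themselves, on `DoorA26`, on `MatrixDescartes` (stmt-ValiantsHypothesis-18050) or on
`VP ≠ VNP`; registers unchanged.

Seat val-sym-door-p2 g12 (W1 #15), `--supports stmt-ValiantsHypothesis-19979 --as helper`. [this work] assembly of p653192's transfer with p657763's count.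
-/

-- `Summit.ValiantsHypothesis.ValiantsHypothesis.…` repeats a component by the D-0017 layout
-- (single-conjunct summit), which the `dupNamespace` linter flags; the name is mandated.
set_option linter.dupNamespace false

namespace Summit.ValiantsHypothesis.ValiantsHypothesis.Theorems.LacunarySymmetroidMatrixDescartes.WallBubbling

open Finset Filter Topology
open scoped BigOperators

/-- **THE WALL DOOR STEP (door-free).**  With the confluent `(2,6)` determinant INLINED: if its five exponents carry a coincidence of two distinct
canonical pair sums and it is not identically zero, then smooth window functions converging to it continuously with all derivatives of order `< 20`
on `[A,B]`, each with `20` distinct zeros in `[A,B]`, do not exist. [this work] -/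
theorem no_twenty_window_of_coincidence
    (e : Fin 5 → ℝ) (τ T : Matrix (Fin 2) (Fin 2) ℝ) (S : Fin 4 → Matrix (Fin 2) (Fin 2) ℝ)
    (hcoin : ∃ a b c d : Fin 5, a ≤ b ∧ c ≤ d ∧ (a, b) ≠ (c, d) ∧ e a + e b = e c + e d)
    (hne : ∃ t, ((Real.exp (e 0 * t)) • (τ + t • T) + ∑ k, (Real.exp (e k.succ * t)) • S k).det ≠ 0)
    (A B : ℝ) (f : ℕ → ℝ → ℝ) (hf : ∀ ν (n : ℕ), ContDiff ℝ n (f ν))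
    (hconv : ∀ j < 20, ∀ φ : ℕ → ℕ, StrictMono φ → ∀ (t : ℕ → ℝ) (t₀ : ℝ), (∀ k, t k ∈ Set.Icc A B) →
      Tendsto t atTop (𝓝 t₀) → Tendsto (fun k => iteratedDeriv j (f (φ k)) (t k)) atTop
        (𝓝 (iteratedDeriv j (fun t => ((Real.exp (e 0 * t)) • (τ + t • T) + ∑ k, (Real.exp (e k.succ * t)) • S k).det) t₀)))
    (hz : ∀ ν, ∃ z : Fin 20 → ℝ, StrictMono z ∧ ∀ i, z i ∈ Set.Icc A B ∧ f ν (z i) = 0) : False := by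
  obtain ⟨Z, m, hZ, h20⟩ := multiplicity_transfer_iteratedDeriv A B f _ hf hconv hz
  have h19 := Bubbling.confluentDoor_conclusion_of_coincidence e τ T S hcoin hne Z m fun z hz' j hj => (hZ z hz').2 j hj
  omega

end Summit.ValiantsHypothesis.ValiantsHypothesis.Theorems.LacunarySymmetroidMatrixDescartes.WallBubbling
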